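import Mathlib
import Literature.AlgebraicGeometry.Resolution.AbhyankarRationalUniformization
import HarnessLib

/-!
# Knaf–Kuhlmann 2005, Thm. 4.1 (field case) with PRESCRIBED NON-NEGATIVE EXPONENTS — the torus of the «Moreover» clause

Route `RadicialJung`, crux `CleanModels` (stmt-ResolutionOfSingularities-15917), line `Sketch` rev 35; explicit-unit seat `decomp-res-hand-1` g3.
GROUNDWORK (step 3 = `thm41′` of the recipe in `Cruxes/CleanModels/Lines/Sketch-memo-hand1-g3.md` §7) for the discharge of the printed input
`Literature.AlgebraicGeometry.Resolution.KnafKuhlmann2005_Thm11_monomialForm` (Knaf–Kuhlmann 2005, Thm. 1.1 WITH its monomial clause).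
The tree's PROVED `knafKuhlmann2005_thm41_field` (`AbhyankarRationalUniformization.lean:307`; KK05 Thm. 4.1 with `R = K` from Lemma 4.2 =
`knafKuhlmann2005_lemma42_matrix`) chooses the Perron basis `x'` of the value lattice so that a prescribed finite `Z ⊆ 𝒪_P ∩ K(x, y)` lies in
`K[x', y]_{centre}`.  For the monomial clause (KK05 p. 13) the SAME basis change must moreover send finitely many prescribed exponent vectors
`m ∈ ℤ^ρ` with `v(x^m) ≤ 1` (the values `v ζ = v(x^{m_ζ})` of the non-zero `ζ ∈ Z`) into `ℕ^ρ`; Lemma 4.2 (loc. cit., hypothesis `H`) accepts any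
finite set of such vectors, so this file re-runs the tree's proof verbatim with `H ∪ Dx` in place of `H` and records the extra conclusion.

* `thm41_field_pos` — `knafKuhlmann2005_thm41_field` + input `(Dx, hDx)` + output `∀ m ∈ Dx, ∃ c : Fin ρ → ℕ, x^m = ∏ x'ⱼ^{cⱼ}`.

OURS (one extra finite set threaded through a landed proof; the mathematics is Knaf–Kuhlmann's Lemma 4.2 / Thm. 4.1); proves nothing about resolution
of singularities in characteristic `p`. counted 0.
-/

noncomputable section

set_option linter.dupNamespace false -- mandated namespace of this single-conjunct summit

open IsLocalRing
open Literature.AlgebraicGeometry.Resolution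

namespace Summit.ResolutionOfSingularities.ResolutionOfSingularities.Theorems.RadicialJung.CleanModels

namespace KK05ValueBasis

universe u

variable {Ω : Type u} [Field Ω]

/-- **Knaf–Kuhlmann 2005, Thm. 4.1 (case `R = K`) with prescribed non-negative exponents.**  As `knafKuhlmann2005_thm41_field` (`K ⊆ 𝒪_P`,
`xᵢ ≠ 0` with values ℤ-independent, `yⱼ ∈ 𝒪_P` with residues algebraically independent over `KP`, `Z ⊆ 𝒪_P ∩ K(x, y)` finite ⇒ a Perron basis `x'`,
positive values, `K(x') = K(x)`, `Z ⊆ K[x', y]_{centre}`), and IN ADDITION: every exponent vector `m` of a prescribed finite `Dx ⊆ ℤ^ρ` with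
`v(x^m) ≤ 1` becomes non-negative, `x^m = ∏ x'ⱼ^{cⱼ}` with `c ∈ ℕ^ρ`. [cite: KnafKuhlmann2005, Lemma 4.2 and Thm. 4.1 (pp. 9–11), proof of Thm. 1.1 (p. 13)] -/
theorem thm41_field_pos (V : ValuationSubring Ω) (K : Subfield Ω) (hKV : ∀ c ∈ K, c ∈ V) {ρ τ : ℕ} (x : Fin ρ → Ω) (y : Fin τ → Ω) (hx0 : ∀ i, x i ≠ 0)
    (hxi : ∀ m : Fin ρ → ℤ, (∃ b ∈ K, (∏ i, V.valuation (x i) ^ (m i)) = V.valuation b) → m = 0)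
    (hy : ∀ j, y j ∈ V)
    (hri : AlgebraicIndependent (resField V K) (fun j => residue V ⟨y j, hy j⟩))
    (Z : Finset Ω)
    (hZ : ∀ z ∈ Z, z ∈ V ∧ z ∈ Subfield.closure ((K : Set Ω) ∪ (Set.range x ∪ Set.range y)))
    (Dx : Finset (Fin ρ → ℤ)) (hDx : ∀ m ∈ Dx, (∏ i, V.valuation (x i) ^ (m i)) ≤ 1) :
    ∃ x' : Fin ρ → Ω,
      (∀ m ∈ Dx, ∃ c : Fin ρ → ℕ, (∏ i, x i ^ (m i)) = ∏ j, x' j ^ (c j)) ∧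
      (∀ j, x' j ∈ Subfield.closure ((K : Set Ω) ∪ (Set.range x ∪ Set.range y)) ∧
        x' j ≠ 0 ∧ V.valuation (x' j) < 1) ∧
      (∀ i, x i ∈ Subfield.closure ((K : Set Ω) ∪ Set.range x')) ∧
      (∀ m : Fin ρ → ℤ,
        (∃ b ∈ K, (∏ j, V.valuation (x' j) ^ (m j)) = V.valuation b) → m = 0) ∧
      AlgebraicIndependent K (Sum.elim x' y) ∧
      ∀ z ∈ Z, ∃ a ∈ Algebra.adjoin K (Set.range x' ∪ Set.range y),
        ∃ b ∈ Algebra.adjoin K (Set.range x' ∪ Set.range y), V.valuation b = 1 ∧ z = a / b := by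
  classical
  set F₀ := Subfield.closure ((K : Set Ω) ∪ (Set.range x ∪ Set.range y)) with hF₀
  have hvx0 : ∀ i, V.valuation (x i) ≠ 0 := fun i => (map_ne_zero V.valuation).mpr (hx0 i)
  -- representation data for the non-zero elements of `Z`
  have hrep : ∀ ζ : Z, ∃ (F G : MvPolynomial (Fin ρ) (MvPolynomial (Fin τ) K))
      (e₁ : Fin ρ →₀ ℕ), (ζ : Ω) ≠ 0 →
        ((ζ : Ω) = MvPolynomial.eval₂ (MvPolynomial.aeval y).toRingHom x F /
            MvPolynomial.eval₂ (MvPolynomial.aeval y).toRingHom x G ∧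
        V.valuation (MvPolynomial.eval₂ (MvPolynomial.aeval y).toRingHom x G) =
          ∏ i, V.valuation (x i) ^ (e₁ i) ∧
        ∀ e ∈ G.support ∪ F.support,
          (∏ i, V.valuation (x i) ^ (e i)) ≤ ∏ i, V.valuation (x i) ^ (e₁ i)) := by
    intro ζ
    by_cases h0 : (ζ : Ω) = 0
    · exact ⟨0, 0, 0, fun h => (h h0).elim⟩
    · obtain ⟨F, G, e₁, h⟩ := exists_rep_of_mem_valuationSubring V K hKV hx0 hxi hy hri
        (hZ ζ ζ.2).2 (hZ ζ ζ.2).1 h0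
      exact ⟨F, G, e₁, fun _ => h⟩
  choose Fp Gp e1 hspec using hrep
  -- the finite set `H` of exponent differences
  let dif : Z → (Fin ρ →₀ ℕ) → (Fin ρ → ℤ) := fun ζ e i => (e i : ℤ) - (e1 ζ i : ℤ)
  let H : Finset (Fin ρ → ℤ) := ((Finset.univ.filter fun ζ : Z => (ζ : Ω) ≠ 0).biUnion
    fun ζ => ((Gp ζ).support ∪ (Fp ζ).support).image (dif ζ)) ∪ Dx
  have hdifH : ∀ ζ : Z, (ζ : Ω) ≠ 0 → ∀ e ∈ (Gp ζ).support ∪ (Fp ζ).support, dif ζ e ∈ H := by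
    intro ζ hζ e he
    exact Finset.mem_union_left _ (Finset.mem_biUnion.mpr ⟨ζ, Finset.mem_filter.mpr ⟨Finset.mem_univ _, hζ⟩,
      Finset.mem_image.mpr ⟨e, he, rfl⟩⟩)
  have hDxH : ∀ m ∈ Dx, m ∈ H := fun m hm => Finset.mem_union_right _ hm
  have hvdif : ∀ (ζ : Z) (e : Fin ρ →₀ ℕ), (∏ i, V.valuation (x i) ^ (dif ζ e i)) =
      (∏ i, V.valuation (x i) ^ (e i)) / ∏ i, V.valuation (x i) ^ (e1 ζ i) := by
    intro ζ e
    rw [← Finset.prod_div_distrib]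
    refine Finset.prod_congr rfl fun i _ => ?_
    simp only [dif]
    rw [zpow_sub₀ (hvx0 i), zpow_natCast, zpow_natCast]
  have hH : ∀ h ∈ H, (∏ i, V.valuation (x i) ^ (h i)) ≤ 1 := by
    intro h hh
    rcases Finset.mem_union.mp hh with hh | hh
    swap
    · exact hDx h hh
    obtain ⟨ζ, hζ, hh⟩ := Finset.mem_biUnion.mp hh
    have hζ0 : (ζ : Ω) ≠ 0 := (Finset.mem_filter.mp hζ).2
    obtain ⟨e, he, rfl⟩ := Finset.mem_image.mp hh
    obtain ⟨-, -, hdom⟩ := hspec ζ hζ0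
    rw [hvdif]
    exact div_le_one_of_le₀ (hdom e he) zero_le
  -- Lemma 4.2
  have hτind : ∀ m : Fin ρ → ℤ, (∏ i, V.valuation (x i) ^ (m i)) = 1 → m = 0 :=
    fun m hm => hxi m ⟨1, K.one_mem, by rw [hm, map_one]⟩
  obtain ⟨C, D, hCD, hDC, hpos, hexp⟩ :=
    knafKuhlmann2005_lemma42_matrix V.ValueGroup ρ (fun i => V.valuation (x i)) hvx0 hτind H hH
  -- the new variables `x'ⱼ := x^{Cⱼ}`
  let x' : Fin ρ → Ω := fun j => ∏ i, x i ^ (C j i)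
  have hvx' : ∀ j, V.valuation (x' j) = ∏ i, V.valuation (x i) ^ (C j i) := fun j =>
    valuation_prod_zpow x V (C j)
  have hx'lt : ∀ j, V.valuation (x' j) < 1 := fun j => by rw [hvx']; exact hpos j
  have hx'0 : ∀ j, x' j ≠ 0 := fun j => prod_zpow_ne_zero x hx0 _
  have hxF₀ : ∀ i, x i ∈ F₀ := fun i => Subfield.subset_closure (Or.inr (Or.inl ⟨i, rfl⟩))
  have hx'F : ∀ j, x' j ∈ F₀ := fun j => prod_zpow_mem x hxF₀ (C j)
  -- `x` in terms of `x'`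
  have hxx' : ∀ i, x i = ∏ j, x' j ^ (D i j) := by
    intro i
    have h1 : (∏ j, x' j ^ (D i j)) = ∏ i', x i' ^ ((∑ j, D i j • C j) i') := by
      rw [prod_zpow_sum x hx0]
      exact Finset.prod_congr rfl fun j _ => (prod_zpow_zsmul x (D i j) (C j)).symm
    have h2 : (∑ j, D i j • C j) = Pi.single i 1 := by
      funext k
      rw [Finset.sum_apply]
      simp only [Pi.smul_apply, smul_eq_mul]
      have hik := congr_fun (congr_fun hDC i) k
      rw [Matrix.mul_apply] at hik
      rw [hik, Matrix.one_apply, Pi.single_apply]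
      by_cases h : i = k
      · subst h; simp
      · rw [if_neg h, if_neg (Ne.symm h)]
    rw [h1, h2, prod_zpow_single]
  have hxF' : ∀ i, x i ∈ Subfield.closure ((K : Set Ω) ∪ Set.range x') := fun i => by
    rw [hxx' i]
    exact prod_zpow_mem x' (fun j => Subfield.subset_closure (Or.inr ⟨j, rfl⟩)) (D i)
  -- value independence of `x'`
  have hx'i : ∀ m : Fin ρ → ℤ,
      (∃ b ∈ K, (∏ j, V.valuation (x' j) ^ (m j)) = V.valuation b) → m = 0 := by
    rintro m ⟨b, hb, hm⟩
    have key : (∏ j, V.valuation (x' j) ^ (m j)) =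
        ∏ i, V.valuation (x i) ^ ((∑ j, m j • C j) i) := by
      rw [← valuation_prod_zpow x V, prod_zpow_sum x hx0, map_prod]
      refine Finset.prod_congr rfl fun j _ => ?_
      rw [prod_zpow_zsmul, map_zpow₀]
    have h0 := hxi (∑ j, m j • C j) ⟨b, hb, by rw [← key]; exact hm⟩
    funext k
    have hk : m k = ∑ i, (∑ j, m j • C j) i * D i k := by
      have hmul : ∀ j, (∑ i, m j * C j i * D i k) = m j * (C * D) j k := fun j => by
        rw [Matrix.mul_apply, Finset.mul_sum]
        exact Finset.sum_congr rfl fun i _ => by ring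
      simp only [Finset.sum_apply, Pi.smul_apply, smul_eq_mul, Finset.sum_mul]
      rw [Finset.sum_comm]
      simp only [hmul, hCD, Matrix.one_apply, mul_ite, mul_one, mul_zero, Finset.sum_ite_eq',
        Finset.mem_univ, if_true]
    rw [hk, h0]
    simp
  have hind : AlgebraicIndependent K (Sum.elim x' y) :=
    algebraicIndependent_sumElim_of_valIndep V K x' y hx'0 hx'i hy hri
  -- monomials with exponent in `H` are monomials in `x'`
  set A := Algebra.adjoin K (Set.range x' ∪ Set.range y) with hA
  have hmonoA : ∀ h ∈ H, (∏ i, x i ^ (h i)) ∈ A := by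
    intro h hh
    obtain ⟨e, he⟩ := hexp h hh
    have hsum : h = ∑ j, (e j : ℤ) • C j := by
      funext i
      rw [he i]
      simp only [Finset.sum_apply, Pi.smul_apply, smul_eq_mul]
    rw [hsum, prod_zpow_sum x hx0]
    refine prod_mem fun j _ => ?_
    rw [prod_zpow_zsmul, zpow_natCast]
    have hj : x' j ∈ A := Algebra.subset_adjoin (Or.inl ⟨j, rfl⟩)
    exact pow_mem hj _
  have hcoefA : ∀ (P : MvPolynomial (Fin ρ) (MvPolynomial (Fin τ) K)) (e : Fin ρ →₀ ℕ),
      MvPolynomial.aeval y (P.coeff e) ∈ A := by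
    intro P e
    have hmem : MvPolynomial.aeval y (P.coeff e) ∈ Algebra.adjoin K (Set.range y) := by
      rw [Algebra.adjoin_range_eq_range_aeval]
      exact ⟨_, rfl⟩
    exact Algebra.adjoin_mono Set.subset_union_right hmem
  have hDxmono : ∀ m ∈ Dx, ∃ c : Fin ρ → ℕ, (∏ i, x i ^ (m i)) = ∏ j, x' j ^ (c j) := by
    intro m hm
    obtain ⟨e, he⟩ := hexp m (hDxH m hm)
    refine ⟨e, ?_⟩
    have hsum : m = ∑ j, (e j : ℤ) • C j := by
      funext i
      rw [he i]
      simp only [Finset.sum_apply, Pi.smul_apply, smul_eq_mul]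
    rw [hsum, prod_zpow_sum x hx0]
    exact Finset.prod_congr rfl fun j _ => by rw [prod_zpow_zsmul, zpow_natCast]
  refine ⟨x', hDxmono, fun j => ⟨hx'F j, hx'0 j, hx'lt j⟩, hxF', hx'i, hind, fun z hz => ?_⟩
  by_cases hz0 : z = 0
  · exact ⟨0, A.zero_mem, 1, A.one_mem, by rw [map_one], by rw [hz0, zero_div]⟩
  obtain ⟨hrepz, hvG, -⟩ := hspec ⟨z, hz⟩ hz0
  set ζ : Z := ⟨z, hz⟩ with hζ
  set M := (∏ i, x i ^ ((e1 ζ i : ℤ))) with hM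
  have hM0 : M ≠ 0 := prod_zpow_ne_zero x hx0 fun i => (e1 ζ i : ℤ)
  have hmon_eq : ∀ e : Fin ρ →₀ ℕ, (∏ i, x i ^ (e i)) = (∏ i, x i ^ (dif ζ e i)) * M := by
    intro e
    rw [hM, ← prod_zpow_add x hx0, ← prod_zpow_natCast]
    congr 1
    funext i
    simp [dif]
  have hdiv : ∀ P : MvPolynomial (Fin ρ) (MvPolynomial (Fin τ) K),
      (∀ e ∈ P.support, (∏ i, x i ^ (dif ζ e i)) ∈ A) →
      MvPolynomial.eval₂ (MvPolynomial.aeval y).toRingHom x P / M ∈ A := by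
    intro P hP
    have heq : MvPolynomial.eval₂ (MvPolynomial.aeval y).toRingHom x P / M =
        ∑ e ∈ P.support, MvPolynomial.aeval y (P.coeff e) * ∏ i, x i ^ (dif ζ e i) := by
      rw [eval₂_aeval_eq K x y P, Finset.sum_div]
      refine Finset.sum_congr rfl fun e _ => ?_
      rw [hmon_eq e, ← mul_assoc, mul_div_assoc, div_self hM0, mul_one]
    rw [heq]
    exact sum_mem fun e he => mul_mem (hcoefA P e) (hP e he)
  have haA := hdiv (Fp ζ) fun e he => hmonoA _ (hdifH ζ hz0 e (Finset.mem_union_right _ he))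
  have hbA := hdiv (Gp ζ) fun e he => hmonoA _ (hdifH ζ hz0 e (Finset.mem_union_left _ he))
  refine ⟨_, haA, _, hbA, ?_, ?_⟩
  · rw [map_div₀, hvG, hM, valuation_prod_zpow]
    simp only [zpow_natCast]
    exact div_self (Finset.prod_ne_zero_iff.mpr fun i _ => pow_ne_zero _ (hvx0 i))
  · rw [div_div_div_cancel_right₀ hM0]
    exact hrepz

end KK05ValueBasis

end Summit.ResolutionOfSingularities.ResolutionOfSingularities.Theorems.RadicialJung.CleanModels

end
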